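import Literature.NumberTheory.NumberFields.ArtinMapDecompositionInertia
import Literature.NumberTheory.NumberFields.InertiaGeneratesGalois
import Literature.NumberTheory.GaloisRepresentations.ArtinRestriction
import Literature.NumberTheory.EllipticCurves.KummerUnramified
import HarnessLib

/-!
# Crux `GoodLatticeBDPValue` (stmt-BirchSwinnertonDyer-19032), line `halves`, AN-3 Stub B road — brick F4c:
# ARITHMETIC MONODROMY in `Γ_ℚ`-currency: an open normal subgroup of `Γ_ℚ` containing every inertia
# group is all of `Γ_ℚ` (Cassels, *Local Fields* Ch. 10 Thm. 12.1; Minkowski)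

Width seat bsd-line-x1-p1-w3 (gen 4). HONEST FRAMING (cell `bsd-eis`, run/shared/lean/pub/bsd-eis/):
TOOL THEOREMS ONLY (no `def`, no named fact, no `sorry`); classical algebraic number theory; nothing
about a summit statement, Keller–Yin Thm. 2.2.2 or crux 2 is proved here; 0 stubs / cells / labels move.

WHY (road memo `HOME/line-x1-p1-w3-g4/AN3-StubB-elementary-road.md`, evidence on the item, global
input (G-ℚ), step A4). The elementary proof of Theorem T′ ends with a character `ψ` of `Γ_ℚ` with
finite image (the action on `E[9]/L₉`) killing EVERY inertia group; it must be trivial. This is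
Cassels' "arithmetic monodromy" (the tree's finite-level `NumberFields.InertiaGeneratesGalois.iSup_inertia_eq_top`,
from Minkowski) read in the absolute Galois group: the fixed field `F = ℚ̄^N` of an open normal
`N ≤ Γ_ℚ` is a finite Galois number field whose inertia groups `I(Q) ≤ Gal(F/ℚ)` are the images
of the absolute inertia groups (Serre, *Local Fields* I §7 Prop. 22 (b); tree
`NumberFields.ArtinMapDecompositionInertia.inertia_comap_ringOfIntegers_eq_map_absRestrictNormalHom`),
hence trivial if `N` contains them; so `Gal(F/ℚ) = ⨆ I(Q) = 1`, `F = ℚ`, `N = Γ_ℚ`. (The index-`2`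
case is the tree's `MatarNekovar2019.not_forall_inertia_le_of_index_two`, whose set-up is followed.)

* `exists_isPrime_comap_ringOfIntegersToIntegralClosure_eq'` — a prime of `\bar ℤ_K` above a prime
  of `𝓞 L` (public copy of the MatarNekovar file's private helper);
* **`eq_top_of_isOpen_of_forall_inertia_le`** — `N ≤ Γ_ℚ` open normal with `I_𝔓 ≤ N` for every
  maximal `𝔓 ⊆ \bar ℤ` ⟹ `N = ⊤`;
* `monoidHom_eq_one_of_forall_inertia_le_ker` — a homomorphism `ψ : Γ_ℚ →* A` with OPEN kernel
  killing every inertia group is trivial.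

References: [Cassels1986] J. W. S. Cassels, *Local Fields*, Ch. 10 Thm. 12.1; [NeukirchANT1999]
Ch. III (2.17)–(2.18); [SerreLocalFields1979] Ch. I §7 Prop. 22 (b).
-/

set_option autoImplicit false
set_option linter.dupNamespace false

noncomputable section

open scoped Classical NumberField Pointwise

open Field IsDedekindDomain NumberField
  Literature.NumberTheory.EllipticCurves Literature.NumberTheory.GaloisRepresentations
  Literature.NumberTheory.NumberFields

namespace Summit.BirchSwinnertonDyer.BirchSwinnertonDyer.Theorems.FullDescentCassels

/-- A prime of `\bar ℤ_K` above a given prime ideal of `𝓞 L`, for a number field `L ⊆ K̄`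
(integrality of `\bar ℤ_K` over `𝓞 L`). (Public copy of the private helper of
`MatarNekovar2019/IrreducibleOverQuadraticFieldProofs`.) [folklore] -/
theorem exists_isPrime_comap_ringOfIntegersToIntegralClosure_eq' {K : Type} [Field K]
    [NumberField K] (L : IntermediateField K (AlgebraicClosure K)) (Q : Ideal (𝓞 L))
    [Q.IsPrime] :
    ∃ 𝔓 : Ideal (absIntegers (𝓞 K) K), 𝔓.IsPrime ∧
      𝔓.comap (Literature.NumberTheory.EllipticCurves.ringOfIntegersToIntegralClosure (k := K)
        (Ω := AlgebraicClosure K) L) = Q := by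
  set φ : 𝓞 L →+* absIntegers (𝓞 K) K :=
    Literature.NumberTheory.EllipticCurves.ringOfIntegersToIntegralClosure (k := K) (Ω := AlgebraicClosure K) L with hφ
  have hφalg : ∀ x : 𝓞 K, φ (algebraMap (𝓞 K) (𝓞 L) x) =
      algebraMap (𝓞 K) (absIntegers (𝓞 K) K) x := fun x ↦ rfl
  letI : Algebra (𝓞 L) (absIntegers (𝓞 K) K) := φ.toAlgebra
  haveI : IsScalarTower (𝓞 K) (𝓞 L) (absIntegers (𝓞 K) K) :=
    IsScalarTower.of_algebraMap_eq fun x ↦ (hφalg x).symm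
  haveI : Algebra.IsIntegral (𝓞 L) (absIntegers (𝓞 K) K) :=
    ⟨fun x ↦ (Algebra.IsIntegral.isIntegral (R := 𝓞 K) x).tower_top⟩
  obtain ⟨𝔓, -, h𝔓prime, h𝔓Q⟩ := Ideal.exists_ideal_over_prime_of_isIntegral Q
    (⊥ : Ideal (absIntegers (𝓞 K) K))
    (fun x hx ↦ by
      rw [Ideal.mem_comap, Ideal.mem_bot] at hx
      have hx0 : x = 0 :=
        Literature.NumberTheory.EllipticCurves.ringOfIntegersToIntegralClosure_injective L (hx.trans (map_zero _).symm)
      rw [hx0]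
      exact Q.zero_mem)
  exact ⟨𝔓, h𝔓prime, h𝔓Q⟩

/-- **Arithmetic monodromy in `Γ_ℚ`** (Cassels, *Local Fields* Ch. 10 Thm. 12.1, via Minkowski): an
OPEN NORMAL subgroup `N ≤ Γ_ℚ` which contains the inertia group `I_𝔓` of every maximal ideal `𝔓` of
`\bar ℤ` is all of `Γ_ℚ`. Proof: the fixed field `F = ℚ̄^N` is a finite Galois number field; the
inertia group of a prime `Q` of `𝓞 F` in `Gal(F/ℚ)` is the image of `I_𝔓`, `𝔓 ∣ Q`, hence trivial;
by the tree's `iSup_inertia_eq_top` (the Galois group is generated by inertia groups)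
`Gal(F/ℚ) = 1`, so `F = ℚ` and `N = Γ_ℚ`.
[cite: Cassels1986, Ch. 10 §12 Thm. 12.1] [cite: NeukirchANT1999, Ch. III Thm. (2.17)] -/
theorem eq_top_of_isOpen_of_forall_inertia_le (N : Subgroup (absoluteGaloisGroup ℚ)) [hN : N.Normal]
    (hopen : IsOpen (N : Set (absoluteGaloisGroup ℚ)))
    (hall : ∀ (𝔓 : Ideal (absIntegers (𝓞 ℚ) ℚ)), 𝔓.IsMaximal →
      𝔓.inertia (absoluteGaloisGroup ℚ) ≤ N) :
    N = ⊤ := by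
  haveI : Algebra.IsAlgebraic ℚ (AlgebraicClosure ℚ) := AlgebraicClosure.isAlgebraic ℚ
  haveI : Normal ℚ (AlgebraicClosure ℚ) :=
    @IsAlgClosure.normal ℚ (AlgebraicClosure ℚ) _ _ (AlgebraicClosure.instAlgebra ℚ) inferInstance
  haveI : IsGalois ℚ (AlgebraicClosure ℚ) :=
    @IsAlgClosure.isGalois ℚ (AlgebraicClosure ℚ) _ _ (AlgebraicClosure.instAlgebra ℚ) inferInstance
      inferInstance
  -- the fixed field `L = ℚ̄^N`, a finite Galois number field with `Gal(ℚ̄/L) = N`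
  set L := IntermediateField.fixedField N with hLdef
  have hLH : L.fixingSubgroup = N := fixingSubgroup_fixedField_of_isOpen N hopen
  haveI hfd' := finiteDimensional_fixedField_of_isOpen N hopen
  haveI hfd : FiniteDimensional ℚ L := hfd'
  have hidx' := finrank_fixedField_of_isOpen N hopen
  have hidx : Module.finrank ℚ L = N.index := hidx'
  have hnormal : L.fixingSubgroup.Normal := by rw [hLH]; exact hN
  haveI hGal' := (InfiniteGalois.normal_iff_isGalois L).mp hnormal
  haveI hGal : IsGalois ℚ L := hGal'
  haveI : NumberField L := NumberField.mk
  -- every inertia group of `Gal(L/ℚ)` is trivial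
  have hbot : ∀ (Q : Ideal (𝓞 L)) [Q.IsMaximal], Q.inertia (L ≃ₐ[ℚ] L) = ⊥ := by
    intro Q hQmax
    obtain ⟨𝔓, h𝔓prime, h𝔓P⟩ := exists_isPrime_comap_ringOfIntegersToIntegralClosure_eq' L Q
    subst h𝔓P
    haveI := h𝔓prime
    have h𝔓max : 𝔓.IsMaximal := by
      set φ : 𝓞 L →+* absIntegers (𝓞 ℚ) ℚ :=
        Literature.NumberTheory.EllipticCurves.ringOfIntegersToIntegralClosure (k := ℚ) (Ω := AlgebraicClosure ℚ) L with hφ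
      letI : Algebra (𝓞 L) (absIntegers (𝓞 ℚ) ℚ) := φ.toAlgebra
      haveI : IsScalarTower (𝓞 ℚ) (𝓞 L) (absIntegers (𝓞 ℚ) ℚ) :=
        IsScalarTower.of_algebraMap_eq fun x ↦ rfl
      haveI : Algebra.IsIntegral (𝓞 L) (absIntegers (𝓞 ℚ) ℚ) :=
        ⟨fun x ↦ (Algebra.IsIntegral.isIntegral (R := 𝓞 ℚ) x).tower_top⟩
      refine Ideal.isMaximal_of_isIntegral_of_isMaximal_comap (R := 𝓞 L) 𝔓 ?_
      exact hQmax
    have hmap : (𝔓.inertia (absoluteGaloisGroup ℚ)).map (absRestrictNormalHom L) = ⊥ := by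
      rw [eq_bot_iff]
      rintro _ ⟨σ, hσ, rfl⟩
      rw [Subgroup.mem_bot, absRestrictNormalHom_eq_one_iff]
      have hσN : σ ∈ N := hall 𝔓 h𝔓max hσ
      rw [← hLH] at hσN
      exact hσN
    exact (inertia_comap_ringOfIntegers_eq_map_absRestrictNormalHom L 𝔓).trans hmap
  -- Cassels: the Galois group is generated by inertia groups, hence trivial
  have htop := iSup_inertia_eq_top L (L ≃ₐ[ℚ] L)
  have htriv : (⊤ : Subgroup (L ≃ₐ[ℚ] L)) = ⊥ := by
    rw [← htop]
    refine iSup_eq_bot.mpr fun Q ↦ ?_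
    haveI := Q.isMaximal
    exact hbot Q.asIdeal
  -- so `[L : ℚ] = 1` and `N` has index `1`
  have hcard : Nat.card (L ≃ₐ[ℚ] L) = 1 := by
    rw [← Subgroup.card_top, htriv, Subgroup.card_bot]
  have hfin : Module.finrank ℚ L = 1 := by
    rw [← IsGaloisGroup.card_eq_finrank (L ≃ₐ[ℚ] L) ℚ L, hcard]
  rw [hfin] at hidx
  exact Subgroup.index_eq_one.mp hidx.symm

/-- **A homomorphism `ψ : Γ_ℚ → A` with open kernel that kills every inertia group is trivial**
(corollary: apply `eq_top_of_isOpen_of_forall_inertia_le` to `ker ψ`).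
[cite: Cassels1986, Ch. 10 §12 Thm. 12.1] -/
theorem monoidHom_eq_one_of_forall_inertia_le_ker {A : Type*} [Group A]
    (ψ : absoluteGaloisGroup ℚ →* A) (hopen : IsOpen (ψ.ker : Set (absoluteGaloisGroup ℚ)))
    (hall : ∀ (𝔓 : Ideal (absIntegers (𝓞 ℚ) ℚ)), 𝔓.IsMaximal →
      𝔓.inertia (absoluteGaloisGroup ℚ) ≤ ψ.ker) :
    ψ = 1 := by
  have h := eq_top_of_isOpen_of_forall_inertia_le ψ.ker hopen hall
  ext σ
  have hσ : σ ∈ ψ.ker := by rw [h]; exact Subgroup.mem_top σ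
  rw [MonoidHom.mem_ker] at hσ
  rw [hσ, MonoidHom.one_apply]

end Summit.BirchSwinnertonDyer.BirchSwinnertonDyer.Theorems.FullDescentCassels
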